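import Mathlib
import HarnessLib
import Literature.Analysis.FluidPDE.FluidComputerGadgetOneShot
import Summits.NavierStokesRegularity.Statement

/-!
# Fluid computer (Tao's machine paradigm), III: the gadget interface as typed is EXACTLY calibrated to `¬ NavierStokesRegularity`

HONEST FRAMING: low prior, high value-of-information experiment on Tao's machine paradigm;
NOT a claim that NS blows up.

(Cell `pub-fluidc`, blueprint seat bp2, gen 5; classical twin of seat bp3's one-shot degeneracy
observation, ASSEMBLY.md v3 §2e; SPEC-SHEET.md v0.5 §4.)

`Theorems/FluidComputerGadget.lean` proved `ns_blowup_of_gadgetLibrary`: a gadget library with valid,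
closing, super-threshold specs refutes Clay (A). Here the converse is recorded: if Clay (A) fails, then
for the failing viscosity and ANY valid spec a (one-shot, cascade-free) library exists
(`Literature.Analysis.FluidPDE.FluidComputer.oneShotLibrary`). Together:
`¬ NavierStokesRegularity ↔ ∃ ν > 0, ∃ σ valid ∧ closing ∧ super-threshold, Nonempty (GadgetLibrary ν σ)`.
So the typed interface has no content beyond the negation of the summit; the programme's empirical
content is the level-by-level spec-sheet measurement, and a non-degenerate ("live") interface over local
solutions is future work. Nothing here asserts that any library exists.
-/

set_option linter.dupNamespace false -- nested layout Summit.<S>.<Sub>, Sub = S (D-0017)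

namespace Summit.NavierStokesRegularity.NavierStokesRegularity.Theorems

open Literature.Analysis.FluidPDE Literature.Analysis.FluidPDE.FluidComputer

/-- If Clay (A) fails then, at a failing viscosity `ν > 0`, every valid spec admits a gadget library
(the one-shot library on a datum without global regular solution). [folklore] -/
theorem exists_gadgetLibrary_of_not_regularity (hNS : ¬ NavierStokesRegularity) :
    ∃ ν : ℝ, 0 < ν ∧ ∀ σ : GadgetSpec, σ.Valid → Nonempty (GadgetLibrary ν σ) := by
  by_contra hcon
  apply hNS
  intro ν hν v hv₁ hv₂ hv₃
  by_contra hsol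
  exact hcon ⟨ν, hν, fun σ hσ =>
    nonempty_gadgetLibrary_of_noGlobalRegularSolution ν hσ hv₁ hv₂ hv₃ hsol⟩

/-- **The gadget interface as typed is exactly calibrated to the negation of Clay (A).**
`¬ NavierStokesRegularity` holds iff for some viscosity `ν > 0` and some valid, closing,
super-threshold spec `σ` a `GadgetLibrary ν σ` exists. (`⇐` is `ns_blowup_of_gadgetLibrary`,
re-derived in one line; `⇒` is the one-shot library at the unit spec `s = 2`, `k0 = 1`, `alpha = 1`,
`Cplus = 0`, `eta = 1`, `leak = dStar = amp = 0`, `radius = 1`.) Consequently exhibiting a term of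
type `GadgetLibrary ν σ` is neither easier nor harder than refuting Clay (A) directly: the interface
forces no cascade, robustness or rate law non-vacuously.
HONEST FRAMING: a calibration of a typed interface; NOT a claim that NS blows up. [folklore] -/
theorem not_navierStokesRegularity_iff_exists_gadgetLibrary :
    ¬ NavierStokesRegularity ↔
      ∃ ν : ℝ, 0 < ν ∧ ∃ σ : GadgetSpec, σ.Valid ∧ σ.Closure ∧ σ.s⁻¹ < σ.eta ∧
        Nonempty (GadgetLibrary ν σ) := by
  constructor
  · intro hNS
    obtain ⟨ν, hν, h⟩ := exists_gadgetLibrary_of_not_regularity hNS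
    have hval : GadgetSpec.Valid ⟨2, 1, 1, 0, 1, 0, 0, 0, 1⟩ := by constructor <;> norm_num
    exact ⟨ν, hν, ⟨2, 1, 1, 0, 1, 0, 0, 0, 1⟩, hval, ⟨by norm_num⟩, by norm_num, h _ hval⟩
  · rintro ⟨ν, hν, σ, hσ, hclos, hvisc, ⟨lib⟩⟩ hNS
    exact lib.no_global_regular_solution hσ hclos hvisc
      (hNS ν hν lib.seed lib.seed_smooth lib.seed_divFree lib.seed_decay)

end Summit.NavierStokesRegularity.NavierStokesRegularity.Theorems
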